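/-
Copyright (c) 2026 the pub-hodgecm-mathlib formalisation cell (harness21).  Prover seat hodgecm-mathlib-LH4-p03 (g4) on line LH3 (closer stub `stub_N9`, N9 «Transf» road),
brick (J-BOOK) «wall factors at a covered wall» (LH3-plan (g3) 2026-09-02T07:24:10Z «= CUT THE THREE WALL-FACTOR LEMMAS NOW»); 2026-09-02.
-/
import Literature.NumberTheory.Automorphic.ArchCartanNormalisers   -- ★ `archRH`, `archRG`, `archERho`, `archERhoG`, `archERho_mul_archRH`, `coe_circleExp_sub_coe_circleExp_neg`, `norm_one_sub_coe_circleExp_sub`; brings ★ (COORD) `nrm`, `cayPt`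
import HarnessLib

/-!
# The wall factors of the normalisers at a covered wall: `e^{ρ}·R_T` along the normal curve on BOTH sides (`2i sin ν` on `H`, `e^{iν}·2i sin ν·r(ν)` on `G′`),
# the split-chart factor of `R′` at the Cayley point (`|e^{x}−e^{−x}|·|e^{x+iθ}−e^{iφ}|·|e^{−x+iθ}−e^{iφ}|`, ratio `→ |e^{iθ}−e^{iφ}|²`) (Rogawski 1990 §8.2; Shelstad 1979 §4)

Topic `NumberTheory/Automorphic`; namespace `Literature.NumberTheory.Automorphic.ArchCartan`.  THEOREMS ONLY (no `def`, no instance, no notation, no axiom, no named fact, no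
`sorry`); kernel lane `--supports stmt-HodgeConjecture-24833`.  Cell `pub/hodgecm-mathlib` (D-0151), crux H413 = `stmt-HodgeConjecture-24833`; line LH3 (closer stub `stub_N9`,
N9 «Transf» DIRECT ROAD), brick **(J-BOOK)** = the bookkeeping half of organ J `JumpAgreementStatement` (LH4-p03 (g4) J-CENSUS v1 2026-09-02T07:20Z §(i)–(iii); LH3-plan (g3)
07:24:10Z): the two jump constants read `jcH S w = jump_H ∕ Cay_H` and `jc′ S w 0 2 = jump_{G′} ∕ Cay_{G′}`, and everything in these four numbers EXCEPT the rank-one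
data `C₁` (the `2 sin ψ`-jump of the elliptic `U(1,1)` orbital integral, ★ (K0±)) and `C₂` (the `|D|^{1∕2}`-limit of the hyperbolic one at `x = 0`, (A0-b)) is the value of a
NORMALISER at the wall.  This file computes those values once, generically in the place set `W` (no group, no measure): consumers (J-H) LH10-p02 (g3), (J-G′)∕(G′-CAY), the J head.
HONEST LABEL: HC_CM is proved only modulo the 7 printed citations (2 remaining: hLiu418 = stmt-HodgeConjecture-24832, h413 = stmt-HodgeConjecture-24833) until rung 0 closes;
count-neutral kit (trigonometry of the normalisers), pays nothing by itself.

THE MATHEMATICS.  Fix a compact place `w` (`w ∉ S`) and a point `s` ON the wall `s w 0 = s w 2 =: θ` of the chart `S`, `φ := s w 1`; the normal curve is `s + ν • nrm w`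
(angles `θ + ν, φ, θ − ν` at `w`, ★ `add_smul_nrm_apply_self`; `hcNrm w 0 2 = nrm w`, ★ `hcNrm_zero_two`).  Every normaliser is a product over the places of a factor reading
only that place's coordinates (★ defs :111–:132), so along the normal only the `w`-factor moves:
* `H` side: `archERho S · archRH S` has `w`-factor `e^{i(θ₀−θ₂)∕2}(1 − e^{i(θ₂−θ₀)}) = 2i sin((θ₀−θ₂)∕2)` (★ `archERho_mul_archRH`), `= 2i sin ν` along the normal
  (`archERho_mul_archRH_add_smul_nrm`): the `2 sin ψ` of ★ (K0±) up to the constant `i`;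
* `G′` side, compact chart: `archERhoG S′ · archRG S′` has `w`-factor `e^{i(θ₀−θ₂)}·Π_{i<j}(1 − e^{i(θ_j−θ_i)})` = along the normal `e^{iν}·2i sin ν · r_ν` with
  `r_ν := (1 − e^{i(φ−θ−ν)})(1 − e^{i(θ−ν−φ)})` (`archERhoG_mul_archRG_add_smul_nrm`), and `r_0 = (1 − e^{i(φ−θ)})(1 − e^{i(θ−φ)}) = |e^{iθ} − e^{iφ}|²`
  (`one_sub_circleExp_mul_one_sub_circleExp_symm`), `r_ν → |e^{iθ} − e^{iφ}|²` and `e^{iν} → 1` (`tendsto_compactWallFactor_nhds_zero`);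
* `G′` side, split chart `insert w S′` (the Cayley side): `archRG (insert w S′)` has `w`-factor `|e^{x}−e^{−x}|·|e^{x+iθ}−e^{iφ}|·|e^{−x+iθ}−e^{iφ}|` with the last two
  factors `→ |e^{iθ}−e^{iφ}|²` as `x → 0` (`tendsto_splitWallFactor_nhds_zero`), and `archERhoG (insert w S′)` does not read `w` (`archERhoG_insert_update`); on `H`,
  ★ `archERho_insert_cayPt`, ★ `archRH_insert_cayPt` (= 0) are already in the tree.
So the non-rank-one parts of `jump_{G′}` and `Cay_{G′}` are BOTH `|e^{iθ}−e^{iφ}|² ×` (the common product over `w′ ≠ w`), and those of `jump_H`, `Cay_H` are both `1 ×` (common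
product): they cancel in each ratio, leaving `jcH = 2i·C₁∕C₂` (the `2` = the STABLE doubling `γ, γ″` of ★ `stOrbFamH`'s flip sum at `w`) and `jc′ = i·C₁∕C₂` — J's literal `2`.

* §1 scalar identities: `circleExp_two_mul_mul_one_sub`, `one_sub_circleExp_mul_one_sub_circleExp_symm`, `tendsto_compactWallFactor_nhds_zero`, `tendsto_splitWallFactor_nhds_zero`;
* §2 `H`: **`archERho_mul_archRH_add_smul_nrm`** (+ `archERho_mul_archRH_eq_mul_prod_erase`);
* §3 `G′` compact chart: `archERhoG_mul_archRG_eq_mul_prod_erase`, **`archERhoG_mul_archRG_add_smul_nrm`**;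
* §4 `G′` split chart: **`archRG_insert_eq_mul_prod_erase`**, `archRG_insert_update_eq`, `archERhoG_insert_update`.

## References
* [Rogawski1990] J. D. Rogawski, *Automorphic Representations of Unitary Groups in Three Variables*, Ann. of Math. Stud. 123 (1990), §8.2 pp. 118–124 (`2 sin ψ`, the walls of
  the compact Cartan, Prop. 8.2.1 (c) p. 119), §4.9 p. 55 (`D_{G∕H}`).
* [Shelstad1979] D. Shelstad, *Characters and inner forms of a quasi-split group over ℝ*, Compositio Math. 39 (1979), §4 pp. 22–25 (`R_T`, `T^I_reg`, the Cayley transform at a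
  noncompact wall, Lemma 4.3), Prop. 4.5 p. 26 (`d(α)`).
* [Bouaziz1994IntegralesOrbitales] A. Bouaziz, *Intégrales orbitales sur les groupes de Lie réductifs*, Ann. Sci. ÉNS 27 (1994), §3.2 (I₃) p. 580, §6.2 p. 591 (`r_Ψ`).
-/

set_option autoImplicit false

noncomputable section

open Complex Set Function Real Filter Topology

namespace Literature.NumberTheory.Automorphic.ArchCartan

variable {W : Type*}

/-! ## §1 Scalar identities at one place -/

/-- `e^{2iν}(1 − e^{−2iν}) = e^{iν}·2i sin ν`. [cite: Rogawski1990, §8.2 p. 122] -/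
theorem circleExp_two_mul_mul_one_sub (ν : ℝ) :
    (Circle.exp (2 * ν) : ℂ) * (1 - (Circle.exp (-(2 * ν)) : ℂ)) = (Circle.exp ν : ℂ) * (2 * I * Real.sin ν) := by
  rw [← coe_circleExp_sub_coe_circleExp_neg]
  simp only [Circle.coe_exp, Complex.ofReal_neg, Complex.ofReal_mul, Complex.ofReal_ofNat]
  rw [mul_sub, mul_one, ← Complex.exp_add, mul_sub, ← Complex.exp_add, ← Complex.exp_add]
  congr 1
  · congr 1; ring
  · congr 1; ring

/-- **`(1 − e^{i(b−a)})(1 − e^{i(a−b)}) = |e^{ia} − e^{ib}|²`** (`u ū = 1` for the unit `u = e^{i(b−a)}`; ★ `norm_one_sub_coe_circleExp_sub`). [cite: Shelstad1979, §4 p. 22] -/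
theorem one_sub_circleExp_mul_one_sub_circleExp_symm (a b : ℝ) :
    (1 - (Circle.exp (b - a) : ℂ)) * (1 - (Circle.exp (a - b) : ℂ)) = (((‖(Circle.exp a : ℂ) - Circle.exp b‖ ^ 2 : ℝ)) : ℂ) := by
  have hu : (Circle.exp (a - b) : ℂ) = starRingEnd ℂ (Circle.exp (b - a) : ℂ) := by
    rw [← Circle.coe_inv_eq_conj, ← Circle.exp_neg, neg_sub]
  rw [hu, ← norm_one_sub_coe_circleExp_sub a b, ← Complex.normSq_eq_norm_sq, ← Complex.mul_conj, map_sub (starRingEnd ℂ), map_one (starRingEnd ℂ)]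

/-- The two non-wall root factors of the compact `G′`-chart along the normal tend to `|e^{iθ} − e^{iφ}|²`, and the phase `e^{iν}` to `1`:
`e^{iν}·(1 − e^{i(φ−θ−ν)})(1 − e^{i(θ−ν−φ)}) → |e^{iθ} − e^{iφ}|²` as `ν → 0`. [cite: Rogawski1990, §8.2 p. 122] [cite: Shelstad1979, §4 p. 25] -/
theorem tendsto_compactWallFactor_nhds_zero (θ φ : ℝ) :
    Tendsto (fun ν : ℝ => (Circle.exp ν : ℂ) * ((1 - (Circle.exp (φ - θ - ν) : ℂ)) * (1 - (Circle.exp (θ - ν - φ) : ℂ)))) (𝓝 0)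
      (𝓝 ((((‖(Circle.exp θ : ℂ) - Circle.exp φ‖ ^ 2 : ℝ)) : ℂ))) := by
  have hc : Continuous fun ν : ℝ => (Circle.exp ν : ℂ) * ((1 - (Circle.exp (φ - θ - ν) : ℂ)) * (1 - (Circle.exp (θ - ν - φ) : ℂ))) := by
    have hcoe : Continuous fun z : Circle => (z : ℂ) := continuous_subtype_val
    have h1 : Continuous fun ν : ℝ => (Circle.exp ν : ℂ) := hcoe.comp Circle.exp.continuous
    have h2 : Continuous fun ν : ℝ => (Circle.exp (φ - θ - ν) : ℂ) := hcoe.comp (Circle.exp.continuous.comp (continuous_const.sub continuous_id))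
    have h3 : Continuous fun ν : ℝ => (Circle.exp (θ - ν - φ) : ℂ) :=
      hcoe.comp (Circle.exp.continuous.comp ((continuous_const.sub continuous_id).sub continuous_const))
    exact h1.mul ((continuous_const.sub h2).mul (continuous_const.sub h3))
  have h0 := hc.tendsto 0
  rwa [Circle.exp_zero, Circle.coe_one, one_mul, sub_zero, show θ - 0 - φ = θ - φ by ring, one_sub_circleExp_mul_one_sub_circleExp_symm] at h0

/-- The two complex-root factors of the split `G′`-chart tend to `|e^{iθ} − e^{iφ}|²` at the Cayley point:
`|e^{x+iθ} − e^{iφ}|·|e^{−x+iθ} − e^{iφ}| → |e^{iθ} − e^{iφ}|²` as `x → 0`. [cite: Shelstad1979, §4 p. 25] [cite: Rogawski1990, §8.2 p. 119] -/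
theorem tendsto_splitWallFactor_nhds_zero (θ φ : ℝ) :
    Tendsto (fun x : ℝ => ‖Complex.exp (x + θ * I) - Complex.exp (φ * I)‖ * ‖Complex.exp (-x + θ * I) - Complex.exp (φ * I)‖) (𝓝 0)
      (𝓝 (‖Complex.exp (θ * I) - Complex.exp (φ * I)‖ ^ 2)) := by
  have hc : Continuous fun x : ℝ => ‖Complex.exp (x + θ * I) - Complex.exp (φ * I)‖ * ‖Complex.exp (-x + θ * I) - Complex.exp (φ * I)‖ := by
    have h1 : Continuous fun x : ℝ => Complex.exp (x + θ * I) := Complex.continuous_exp.comp (Complex.continuous_ofReal.add continuous_const)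
    have h2 : Continuous fun x : ℝ => Complex.exp (-x + θ * I) := Complex.continuous_exp.comp (Complex.continuous_ofReal.neg.add continuous_const)
    exact (h1.sub continuous_const).norm.mul (h2.sub continuous_const).norm
  have h0 := hc.tendsto 0
  rwa [Complex.ofReal_zero, neg_zero, zero_add, ← pow_two] at h0

/-! ## §2 The `H`-side factor along the normal: `2i sin ν` -/

section HSide

variable [Fintype W] [DecidableEq W]

/-- `e^{ρ}·R_T` on the `H`-chart `S` splits off its `w`-factor: `archERho S c · archRH S c = f_w(c w) · ∏_{w′ ≠ w} f_{w′}(c w′)` with the per-place factors of ★ `archERho_mul_archRH`.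
[cite: Shelstad1979, §4 p. 22; §4 p. 24] -/
theorem archERho_mul_archRH_eq_mul_prod_erase (S : Finset W) (c : W → Fin 3 → ℝ) (w : W) :
    archERho S c * archRH S c =
      (if w ∈ S then ((|Real.exp (c w 0) - Real.exp (-c w 0)| : ℝ) : ℂ) else 2 * I * Real.sin ((c w 0 - c w 2) / 2)) *
        ∏ w' ∈ Finset.univ.erase w, (if w' ∈ S then ((|Real.exp (c w' 0) - Real.exp (-c w' 0)| : ℝ) : ℂ) else 2 * I * Real.sin ((c w' 0 - c w' 2) / 2)) := by
  rw [archERho_mul_archRH, ← Finset.mul_prod_erase Finset.univ _ (Finset.mem_univ w)]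

/-- **`H`: ALONG THE NORMAL AT A COMPACT WALL THE `w`-FACTOR OF `e^{ρ}·R_T` IS `2i sin ν`**: for `w ∉ S` and `s` on the wall `s w 0 = s w 2`,
`archERho S (s + ν·nrm w) · archRH S (s + ν·nrm w) = 2i sin ν · ∏_{w′ ≠ w} f_{w′}(s w′)` (the other factors frozen at `s`) — the `2 sin ψ` of ★ (K0±) up to `i`.
[cite: Rogawski1990, §8.2 p. 122] [cite: Shelstad1979, §4 p. 24] -/
theorem archERho_mul_archRH_add_smul_nrm (S : Finset W) {w : W} (hw : w ∉ S) {s : W → Fin 3 → ℝ} (hs : s w 0 = s w 2) (ν : ℝ) :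
    archERho S (s + ν • nrm w) * archRH S (s + ν • nrm w) =
      (2 * I * Real.sin ν) *
        ∏ w' ∈ Finset.univ.erase w, (if w' ∈ S then ((|Real.exp (s w' 0) - Real.exp (-s w' 0)| : ℝ) : ℂ) else 2 * I * Real.sin ((s w' 0 - s w' 2) / 2)) := by
  rw [archERho_mul_archRH_eq_mul_prod_erase S _ w, if_neg hw, add_smul_nrm_gap, hs, sub_self, zero_add, mul_div_cancel_left₀ ν two_ne_zero]
  congr 1
  refine Finset.prod_congr rfl fun w' hw' => ?_
  rw [add_smul_nrm_apply_of_ne s ν (Finset.ne_of_mem_erase hw')]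

end HSide

/-! ## §3 The `G′`-side factor on the compact chart along the normal: `e^{iν}·2i sin ν·r_ν` -/

section GCompact

variable [Fintype W] [DecidableEq W]

/-- `e^{ρ}·R′` on the `G′`-chart `S′` splits off its `w`-factor (per-place factors = the bodies of ★ `archERhoG`, ★ `archRG`). [cite: Shelstad1979, §4 p. 22; §4 p. 24] -/
theorem archERhoG_mul_archRG_eq_mul_prod_erase (S' : Finset W) (c : W → Fin 3 → ℝ) (w : W) :
    archERhoG S' c * archRG S' c =
      ((if w ∈ S' then (1 : ℂ) else (Circle.exp (c w 0 - c w 2) : ℂ)) *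
        (if w ∈ S' then
            ((|Real.exp (c w 0) - Real.exp (-c w 0)| *
              ‖Complex.exp (c w 0 + c w 2 * I) - Complex.exp (c w 1 * I)‖ * ‖Complex.exp (-c w 0 + c w 2 * I) - Complex.exp (c w 1 * I)‖ : ℝ) : ℂ)
          else (1 - (Circle.exp (c w 1 - c w 0) : ℂ)) * (1 - (Circle.exp (c w 2 - c w 0) : ℂ)) * (1 - (Circle.exp (c w 2 - c w 1) : ℂ)))) *
        ∏ w' ∈ Finset.univ.erase w,
          ((if w' ∈ S' then (1 : ℂ) else (Circle.exp (c w' 0 - c w' 2) : ℂ)) *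
            (if w' ∈ S' then
                ((|Real.exp (c w' 0) - Real.exp (-c w' 0)| *
                  ‖Complex.exp (c w' 0 + c w' 2 * I) - Complex.exp (c w' 1 * I)‖ * ‖Complex.exp (-c w' 0 + c w' 2 * I) - Complex.exp (c w' 1 * I)‖ : ℝ) : ℂ)
              else (1 - (Circle.exp (c w' 1 - c w' 0) : ℂ)) * (1 - (Circle.exp (c w' 2 - c w' 0) : ℂ)) * (1 - (Circle.exp (c w' 2 - c w' 1) : ℂ)))) := by
  unfold archERhoG archRG
  rw [← Finset.prod_mul_distrib, ← Finset.mul_prod_erase Finset.univ _ (Finset.mem_univ w)]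

/-- **`G′`, COMPACT CHART: ALONG THE NORMAL AT THE WALL `(w, 0, 2)` THE `w`-FACTOR OF `e^{ρ}·R′` IS `e^{iν}·2i sin ν·(1 − e^{i(φ−θ−ν)})(1 − e^{i(θ−ν−φ)})`** (`w ∉ S′`, `p` on
the wall: `p w 0 = p w 2 = θ`, `φ = p w 1`; the `(0,2)` root gives `e^{2iν}(1 − e^{−2iν}) = e^{iν}·2i sin ν`, the two other roots the bracket, whose wall value is `|e^{iθ}−e^{iφ}|²`,
§1); the other places frozen at `p`. [cite: Rogawski1990, §8.2 p. 122] [cite: Shelstad1979, §4 p. 24; Lemma 4.3 (p. 25)] -/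
theorem archERhoG_mul_archRG_add_smul_nrm (S' : Finset W) {w : W} (hw : w ∉ S') {p : W → Fin 3 → ℝ} (hp : p w 0 = p w 2) (ν : ℝ) :
    archERhoG S' (p + ν • nrm w) * archRG S' (p + ν • nrm w) =
      ((Circle.exp ν : ℂ) * (2 * I * Real.sin ν) * ((1 - (Circle.exp (p w 1 - p w 0 - ν) : ℂ)) * (1 - (Circle.exp (p w 0 - ν - p w 1) : ℂ)))) *
        ∏ w' ∈ Finset.univ.erase w,
          ((if w' ∈ S' then (1 : ℂ) else (Circle.exp (p w' 0 - p w' 2) : ℂ)) *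
            (if w' ∈ S' then
                ((|Real.exp (p w' 0) - Real.exp (-p w' 0)| *
                  ‖Complex.exp (p w' 0 + p w' 2 * I) - Complex.exp (p w' 1 * I)‖ * ‖Complex.exp (-p w' 0 + p w' 2 * I) - Complex.exp (p w' 1 * I)‖ : ℝ) : ℂ)
              else (1 - (Circle.exp (p w' 1 - p w' 0) : ℂ)) * (1 - (Circle.exp (p w' 2 - p w' 0) : ℂ)) * (1 - (Circle.exp (p w' 2 - p w' 1) : ℂ)))) := by
  rw [archERhoG_mul_archRG_eq_mul_prod_erase S' _ w, if_neg hw, if_neg hw]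
  congr 1
  · -- the `w`-factor along the normal: angles `(θ + ν, φ, θ − ν)`
    rw [add_smul_nrm_apply_self]
    simp only [Matrix.cons_val_zero, Matrix.cons_val_one, Matrix.cons_val_two, Matrix.tail_cons, Matrix.head_cons]
    rw [hp, show p w 2 + ν - (p w 2 - ν) = 2 * ν by ring, show p w 2 - ν - (p w 2 + ν) = -(2 * ν) by ring,
      show p w 1 - (p w 2 + ν) = p w 1 - p w 2 - ν by ring, show p w 2 - ν - p w 1 = p w 2 - ν - p w 1 by ring]
    calc (Circle.exp (2 * ν) : ℂ) * ((1 - (Circle.exp (p w 1 - p w 2 - ν) : ℂ)) * (1 - (Circle.exp (-(2 * ν)) : ℂ)) * (1 - (Circle.exp (p w 2 - ν - p w 1) : ℂ)))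
        = ((Circle.exp (2 * ν) : ℂ) * (1 - (Circle.exp (-(2 * ν)) : ℂ))) * ((1 - (Circle.exp (p w 1 - p w 2 - ν) : ℂ)) * (1 - (Circle.exp (p w 2 - ν - p w 1) : ℂ))) := by ring
      _ = (Circle.exp ν : ℂ) * (2 * I * Real.sin ν) * ((1 - (Circle.exp (p w 1 - p w 2 - ν) : ℂ)) * (1 - (Circle.exp (p w 2 - ν - p w 1) : ℂ))) := by
          rw [circleExp_two_mul_mul_one_sub]
  · refine Finset.prod_congr rfl fun w' hw' => ?_
    rw [add_smul_nrm_apply_of_ne p ν (Finset.ne_of_mem_erase hw')]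

end GCompact

/-! ## §4 The `G′`-side factor on the split chart `insert w S′` (the Cayley side) -/

section GSplit

variable [Fintype W] [DecidableEq W]

/-- **`G′`, SPLIT CHART AT `w`: `R′_{insert w S′}` splits off its `w`-factor `|e^{x}−e^{−x}|·|e^{x+iθ}−e^{iφ}|·|e^{−x+iθ}−e^{iφ}|`** (`x, φ, θ = c w 0, c w 1, c w 2`); the last
two factors tend to `|e^{iθ}−e^{iφ}|²` at the Cayley point `x → 0` (§1 `tendsto_splitWallFactor_nhds_zero`) — the same wall value as on the compact chart (§3).
[cite: Shelstad1979, §4 p. 25] [cite: Rogawski1990, §8.2 p. 119] -/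
theorem archRG_insert_eq_mul_prod_erase (S' : Finset W) (w : W) (c : W → Fin 3 → ℝ) :
    archRG (insert w S') c =
      ((|Real.exp (c w 0) - Real.exp (-c w 0)| *
          ‖Complex.exp (c w 0 + c w 2 * I) - Complex.exp (c w 1 * I)‖ * ‖Complex.exp (-c w 0 + c w 2 * I) - Complex.exp (c w 1 * I)‖ : ℝ) : ℂ) *
        ∏ w' ∈ Finset.univ.erase w,
          (if w' ∈ insert w S' then
              ((|Real.exp (c w' 0) - Real.exp (-c w' 0)| *
                ‖Complex.exp (c w' 0 + c w' 2 * I) - Complex.exp (c w' 1 * I)‖ * ‖Complex.exp (-c w' 0 + c w' 2 * I) - Complex.exp (c w' 1 * I)‖ : ℝ) : ℂ)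
            else (1 - (Circle.exp (c w' 1 - c w' 0) : ℂ)) * (1 - (Circle.exp (c w' 2 - c w' 0) : ℂ)) * (1 - (Circle.exp (c w' 2 - c w' 1) : ℂ))) := by
  unfold archRG
  rw [← Finset.mul_prod_erase Finset.univ _ (Finset.mem_univ w), if_pos (Finset.mem_insert_self w S')]

/-- The other places' factors of `R′_{insert w S′}` do not read the place `w`: updating `c w` leaves them unchanged. [cite: Shelstad1979, §4 p. 25] -/
theorem archRG_insert_update_prod_erase (S' : Finset W) (w : W) (c : W → Fin 3 → ℝ) (v : Fin 3 → ℝ) :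
    (∏ w' ∈ Finset.univ.erase w,
        (if w' ∈ insert w S' then
            ((|Real.exp (Function.update c w v w' 0) - Real.exp (-Function.update c w v w' 0)| *
              ‖Complex.exp (Function.update c w v w' 0 + Function.update c w v w' 2 * I) - Complex.exp (Function.update c w v w' 1 * I)‖ *
                ‖Complex.exp (-Function.update c w v w' 0 + Function.update c w v w' 2 * I) - Complex.exp (Function.update c w v w' 1 * I)‖ : ℝ) : ℂ)
          else (1 - (Circle.exp (Function.update c w v w' 1 - Function.update c w v w' 0) : ℂ)) * (1 - (Circle.exp (Function.update c w v w' 2 - Function.update c w v w' 0) : ℂ)) *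
            (1 - (Circle.exp (Function.update c w v w' 2 - Function.update c w v w' 1) : ℂ)))) =
      ∏ w' ∈ Finset.univ.erase w,
        (if w' ∈ insert w S' then
            ((|Real.exp (c w' 0) - Real.exp (-c w' 0)| *
              ‖Complex.exp (c w' 0 + c w' 2 * I) - Complex.exp (c w' 1 * I)‖ * ‖Complex.exp (-c w' 0 + c w' 2 * I) - Complex.exp (c w' 1 * I)‖ : ℝ) : ℂ)
          else (1 - (Circle.exp (c w' 1 - c w' 0) : ℂ)) * (1 - (Circle.exp (c w' 2 - c w' 0) : ℂ)) * (1 - (Circle.exp (c w' 2 - c w' 1) : ℂ))) := by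
  refine Finset.prod_congr rfl fun w' hw' => ?_
  rw [Function.update_of_ne (Finset.ne_of_mem_erase hw')]

/-- `archERhoG (insert w S′)` does not read the place `w` (its `w`-factor is `1`): updating `c w` leaves it unchanged — in particular it takes the same value at `c` and at its
Cayley point (`G′`-twin of ★ `archERho_insert_cayPt`). [cite: Shelstad1979, §4 p. 25] -/
theorem archERhoG_insert_update (S' : Finset W) (w : W) (c : W → Fin 3 → ℝ) (v : Fin 3 → ℝ) :
    archERhoG (insert w S') (Function.update c w v) = archERhoG (insert w S') c := by
  unfold archERhoG
  refine Finset.prod_congr rfl fun w' _ => ?_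
  by_cases hw' : w' ∈ insert w S'
  · rw [if_pos hw', if_pos hw']
  · rw [if_neg hw', if_neg hw']
    have hne : w' ≠ w := fun h => hw' (h ▸ Finset.mem_insert_self w S')
    rw [Function.update_of_ne hne]

end GSplit

end Literature.NumberTheory.Automorphic.ArchCartan

end
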